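import Summits.QuantumFields.BalabanUV.Beta.FP.KernelPeriodisationFibTrace
import Summits.QuantumFields.BalabanUV.Beta.BorderedHessianStep

/-!
# `BalabanUV.Beta.FP.TorusGaugeCovariance` — road «FP» (binder row D1), route T, (T-ID) letter «GAUGE COVARIANCE OF THE PERIODISED ROOTED
# AVERAGING»: the U = 1 (colour-blind, background-STATIC) linearised gauge generators on the torus box `KernelPeriodisationFib.Idx M (Fib d)`
# and the MASTER IDENTITY «periodised rooted averaging of a torus gradient = `#B ·` the coarse gradient of its values AT THE BLOCK ROOTS»

OFFER O-gan24leaf05-g48-2 (HOME/CLAIMS.log [GAN24LEAF05-G48-OFFER-2]; GO words: d1-formalise-leaf-06 g16 W-d1leaf06g16-2 «yours is the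
ONE definition» — the (UNI) instance (`CombSliceUnimodular` §3) reads the SAME columns —, d1-formalise-leaf-05 g23 W-d1leaf05g23-3).  Consumer: the
OWNER's integration theorem `NestedStepLawOneShot.secondVar_oneShot_nestedStepLaw` (p307295), covariance binders «`Q₁D₁ = 0`, `Q₁D₂ = D̄`» at the
one-step level of the torus instance.  Unit `b2b-balaban-gan24-formalise-leaf-05` (G-an2-4 swarm leaf prover 05 → road FP (T-ID) co-holder), gen 48.

HONEST FRAMING (cell contract, verbatim): «discharging `BetaPertH` makes Bałaban's UV stability UNCONDITIONAL — a real constructive-QFT result; it is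
NOT the continuum limit and NOT the Clay problem.»  HONEST DEPENDENCY: continuum YM on T⁴ ⇐ BetaPertH ∧ nine spine estimates (0/9 proved);
BetaPertH ⇐ (D1) ∧ (D4) ∧ CAP+tail; G-an2-4 gates asym, D1 and NE2/3/4.  NOT IN PRINT; OUR BOOKKEEPING ([folklore] finite sums + the box × period
lattice unfolding of PART 4).  No `Prop` is minted, nothing is cited; the new `def`s are the bookkeeping objects `tdelta`, `tgrad`, `nearBox`,
`univForm` (none of type `Prop`).  Discharges NO binder of row D1 by itself; NOT (T-ID) complete, NOT (UNI), NOT SDF, NOT D1, NOT BetaPertH, NOT continuum, NOT Clay.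

CONTENT (every `d`).
* §1 `tdelta M x s` (Kronecker delta of `x ∈ ℤ^{d+1}` and the box point `s` modulo `Mℤ^{d+1}`, via `B6Lemma24Torus.wrap`), its periodicity;
  **`tgrad M : Matrix (Idx M (Fib d)) ↥(pbox M) ℝ`** — column `s` = the torus gradient of the periodic indicator of `s` read on the FIELD slots
  (`tgrad_inl`), zero on the multiplier slots (`tgrad_inr`); the block roots are the points with `proj N (x − ρ) = 0` (displayed, no predicate minted).
* §2 [folklore] **THE ROOTED AVERAGING IS REPRESENTED BY ITS BOND COUNTS**: `HasSum (z ↦ Σ_l linCountAt ρ N κ ȳ (l,z) · A l z) (linAvgAt ρ A N κ ȳ)`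
  for EVERY real 1-form `A` (universal coefficients: an1's `linAvgAt_mapForm` at the `Finsupp`-valued universal form; finite support by an1's
  `linCountAt_eq_zero`).
* §3 **MASTER IDENTITY** (in-block root `ρ = toSite r`, `N ≥ 1`, box `M` with `N ∣ M i`, every multiplier row `(p, inr κ)`, every column `s`):
  `Σ_q perF M (bhKAt d ρ N) (p, inr κ) q · tgrad M q s = [proj N p = 0] · N^{d+1} · (tdelta M (p + ρ + N•e_κ) s − tdelta M (p + ρ) s)`
  (an1's `AveragingContoursRooted.linAvgAt_grad` periodised), and the same for `bhKStepAt d ρ Lc j` at every `j` (border = `stepScale ·` that of `bhKAt`).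
* §4 corollary (C1): a column `s` that is NOT a block root is killed by every multiplier row — «`Q₁·D₁ = 0`» for the residual algebra
  «`λ = 0` at the block roots» of the rooted comb chart.
-/

noncomputable section

open scoped BigOperators
open Finset

namespace Summit.QuantumFields.BalabanUV.Beta.FP.TorusGaugeCovariance

open Literature.Probability.LatticeModels (TorusSite Torus.proj Torus.proj_apply)
open Literature.MathematicalPhysics.QuantumFieldTheory
open Literature.MathematicalPhysics.QuantumFieldTheory.Balaban1983to89
open Literature.MathematicalPhysics.QuantumFieldTheory.Balaban1983to89.Beta
open B4TorusKernel.MultiPeriod (translate translate_apply)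
open B6Lemma24Torus (pbox mem_pbox wrap wrap_eq_self wrap_congr)
open ExpKernelCalculus (MKer)
open AffineAveraging (Form0 Form1 box toSite unitVec unitVec_apply)
open AveragingContours (grad)
open AveragingContoursRooted (linAvgAt linAvgAt_grad)
open AveragingHessianKernels (Bond Near δ1 δ1_apply)
open AveragingHessianKernelsRooted (linCountAt linCountAt_eq_zero linAvgAt_mapForm)
open TransportedContourVariables (mapForm mapForm_apply)
open KKTFluctuationKernel (delta1 delta1_apply)
open LatticeForm (quo)
open OneStepResolventKernel (Fib eq_zsmul_quo_of_proj proj_zsmul)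
open Summit.QuantumFields.BalabanUV.Beta.BorderedHessian (bhKAt bhKAt_inr_inl bhKAt_inr_inr bhKStepAt bhKStepAt_zero bhKStepAt_succ_mf
  bhKStepAt_succ_mm stepScale linAvgAt_delta1_eq_cast)
open Summit.QuantumFields.BalabanUV.Beta.FP.KernelPeriodisationFib (Idx perF perF_apply perZ perZ_apply translate_eq_add)
open Summit.QuantumFields.BalabanUV.Beta.FP.KernelPeriodisationFibTrace (tsum_sites_eq_sum_tsum)

variable {d : ℕ}

/-! ## §1 The periodic Kronecker delta, the torus gradient columns, the block roots -/

section Objects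

variable (M : Fin (d + 1) → ℕ)

/-- **Kronecker delta modulo `Mℤ^{d+1}`**: `tdelta M x s = 1` iff the lattice point `x` reduces to the box point `s`. [our object] -/
def tdelta (x : Fin (d + 1) → ℤ) (s : ↥(pbox M)) : ℝ :=
  if wrap M x = (s : Fin (d + 1) → ℤ) then 1 else 0

/-- unfolding `tdelta`. -/
theorem tdelta_apply (x : Fin (d + 1) → ℤ) (s : ↥(pbox M)) :
    tdelta M x s = if wrap M x = (s : Fin (d + 1) → ℤ) then 1 else 0 := rfl

/-- on box points `tdelta` is the plain Kronecker delta. -/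
theorem tdelta_of_mem {x : Fin (d + 1) → ℤ} (hx : x ∈ pbox M) (s : ↥(pbox M)) :
    tdelta M x s = if x = (s : Fin (d + 1) → ℤ) then 1 else 0 := by
  rw [tdelta_apply, wrap_eq_self hx]

/-- `tdelta` is invariant under congruence modulo `Mℤ^{d+1}` in the lattice argument. -/
theorem tdelta_congr {x x' : Fin (d + 1) → ℤ} (h : ∀ i, (M i : ℤ) ∣ x i - x' i) (s : ↥(pbox M)) :
    tdelta M x s = tdelta M x' s := by
  rw [tdelta_apply, tdelta_apply, wrap_congr h]

/-- `tdelta` is `Mℤ^{d+1}`-periodic: `tdelta M (x + M∘m) s = tdelta M x s`. -/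
theorem tdelta_translate (x m : Fin (d + 1) → ℤ) (s : ↥(pbox M)) : tdelta M (translate M x m) s = tdelta M x s :=
  tdelta_congr M (fun i => ⟨m i, by rw [translate_apply]; ring⟩) s

/-- **THE TORUS GRADIENT COLUMNS** (U = 1, colour-blind, background-static linearised gauge generators on the box): column `s` is the
lattice gradient of the periodic indicator of `s`, read on the field slots `inl`; the multiplier slots `inr` carry no gauge action. [our object] -/
def tgrad : Matrix (Idx M (Fib d)) ↥(pbox M) ℝ :=
  fun q s => Sum.elim (fun l : Fin (d + 1) => tdelta M ((q.1 : Fin (d + 1) → ℤ) + unitVec l) s - tdelta M (q.1 : Fin (d + 1) → ℤ) s)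
    (fun _ : Fin (d + 1) => (0 : ℝ)) q.2

/-- one-bond reading of a field row of `tgrad`. -/
theorem tgrad_inl (y : ↥(pbox M)) (l : Fin (d + 1)) (s : ↥(pbox M)) :
    tgrad M (y, Sum.inl l) s = tdelta M ((y : Fin (d + 1) → ℤ) + unitVec l) s - tdelta M (y : Fin (d + 1) → ℤ) s := rfl

/-- multiplier rows of `tgrad` vanish. -/
theorem tgrad_inr (y : ↥(pbox M)) (κ : Fin (d + 1)) (s : ↥(pbox M)) : tgrad M (y, Sum.inr κ) s = 0 := rfl

/-- the field row of `tgrad` IS the lattice gradient of the periodic indicator `x ↦ tdelta M x s`. -/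
theorem tgrad_inl_eq_grad (y : ↥(pbox M)) (l : Fin (d + 1)) (s : ↥(pbox M)) :
    tgrad M (y, Sum.inl l) s = grad (fun x => tdelta M x s) l (y : Fin (d + 1) → ℤ) := rfl

/-- the lattice gradient of the periodic indicator is `Mℤ^{d+1}`-periodic. -/
theorem grad_tdelta_translate (s : ↥(pbox M)) (l : Fin (d + 1)) (x m : Fin (d + 1) → ℤ) :
    grad (fun z => tdelta M z s) l (translate M x m) = grad (fun z => tdelta M z s) l x := by
  simp only [grad]
  rw [show translate M x m + unitVec l = translate M (x + unitVec l) m by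
        funext i; simp only [translate_apply, Pi.add_apply]; ring,
    tdelta_translate, tdelta_translate]

/-! ### Block roots.  The BLOCK ROOTS for the root offset `ρ` and blocking `N` are the lattice points `x ≡ ρ (mod Nℤ^{d+1})`, written
`Torus.proj N (x − ρ) = 0` (an2's coarse-point test `proj N · = 0` shifted by the root; a DECIDABLE equation on the box — the residual
gauge parameters of the rooted comb chart are the box points FAILING it).  No predicate is minted: the equation is displayed verbatim. -/

/-- a point of the form `N•u + ρ` is a block root. -/
theorem proj_sub_eq_zero_of_zsmul_add (ρ : Fin (d + 1) → ℤ) (N : ℕ) (u : Fin (d + 1) → ℤ) : Torus.proj N ((N : ℤ) • u + ρ - ρ) = 0 := by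
  rw [add_sub_cancel_right]
  exact proj_zsmul u

/-- block roots are stable under congruence modulo `Mℤ^{d+1}` when `N ∣ M i`. -/
theorem proj_sub_eq_zero_congr {ρ : Fin (d + 1) → ℤ} {N : ℕ} (hM : ∀ i, N ∣ M i) {x x' : Fin (d + 1) → ℤ} (h : ∀ i, (M i : ℤ) ∣ x i - x' i) :
    Torus.proj N (x - ρ) = 0 ↔ Torus.proj N (x' - ρ) = 0 := by
  have key : ∀ {a b : Fin (d + 1) → ℤ}, (∀ i, (M i : ℤ) ∣ a i - b i) → Torus.proj N (a - ρ) = 0 → Torus.proj N (b - ρ) = 0 := by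
    intro a b hab ha
    funext i
    have hi := congr_fun ha i
    simp only [Torus.proj_apply, Pi.sub_apply, Pi.zero_apply] at hi ⊢
    obtain ⟨k, hk⟩ := hab i
    obtain ⟨c, hc⟩ := hM i
    have e : b i - ρ i = (a i - ρ i) - (M i : ℤ) * k := by linarith
    rw [e, Int.cast_sub, hi, zero_sub, neg_eq_zero, hc]
    push_cast
    rw [ZMod.natCast_self, zero_mul, zero_mul]
  exact ⟨key h, key fun i => by obtain ⟨k, hk⟩ := h i; exact ⟨-k, by linarith⟩⟩

/-- the periodic indicator of a NON-root box point vanishes at every block root (`N ∣ M i`). -/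
theorem tdelta_eq_zero_of_root {ρ : Fin (d + 1) → ℤ} {N : ℕ} (hM : ∀ i, N ∣ M i) {x : Fin (d + 1) → ℤ} (hx : Torus.proj N (x - ρ) = 0)
    {s : ↥(pbox M)} (hs : Torus.proj N ((s : Fin (d + 1) → ℤ) - ρ) ≠ 0) : tdelta M x s = 0 := by
  rw [tdelta_apply, if_neg]
  intro hw
  apply hs
  have hper : ∀ i, (M i : ℤ) ∣ x i - (s : Fin (d + 1) → ℤ) i := fun i => by
    rw [← hw]
    obtain ⟨k, hk⟩ := B6Lemma24Torus.isPeriod_sub_wrap (M := M) x i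
    exact ⟨k, by simpa [Pi.sub_apply] using hk⟩
  exact (proj_sub_eq_zero_congr M hM hper).1 hx

/-- **packed sum = field-slot sum**: against a `tgrad` column only the FIELD slots of a row contribute (the consumer's `Q₁ * D₁` reads the
multiplier-row × field-column block; this lemma moves between the packed index `Idx M (Fib d)` and that block). -/
theorem sum_mul_tgrad_eq_sum_inl {F' : Type*} (X : Matrix F' (Idx M (Fib d)) ℝ) (a : F') (s : ↥(pbox M)) :
    ∑ q : Idx M (Fib d), X a q * tgrad M q s = ∑ y : ↥(pbox M), ∑ l : Fin (d + 1), X a (y, Sum.inl l) * tgrad M (y, Sum.inl l) s := by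
  rw [Fintype.sum_prod_type]
  refine Finset.sum_congr rfl fun y _ => ?_
  rw [Fintype.sum_sum_type]
  simp only [tgrad_inr, mul_zero, Finset.sum_const_zero, add_zero]

end Objects

/-! ## §2 The rooted averaging is represented by its bond counts (universal coefficients) -/

section Representation

/-- the `Finsupp`-valued UNIVERSAL 1-form: bond `(l, z)` carries the generator `single (l,z) 1`. [our object] -/
def univForm (d : ℕ) : Form1 (d + 1) (Bond (d + 1) →₀ ℤ) := fun l z => Finsupp.single (l, z) 1

/-- evaluating the universal form at a bond gives that bond's indicator form. -/
theorem mapForm_applyAddHom_univForm (b : Bond (d + 1)) : mapForm (Finsupp.applyAddHom b) (univForm d) = δ1 b := by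
  funext l z
  rw [mapForm_apply, δ1_apply, univForm, Finsupp.applyAddHom_apply, Finsupp.single_apply]

/-- specialising the universal form along the coefficient functional of a real 1-form `A` returns `A`. -/
theorem mapForm_lift_univForm (A : Form1 (d + 1) ℝ) :
    mapForm (Finsupp.liftAddHom (fun b : Bond (d + 1) => zmultiplesHom ℝ (A b.1 b.2))) (univForm d) = A := by
  funext l z
  rw [mapForm_apply, univForm, Finsupp.liftAddHom_apply_single, zmultiplesHom_apply, one_zsmul]

/-- the rooted averaging of the universal form is the table of bond counts. -/
theorem linAvgAt_univForm_apply (ρ : Fin (d + 1) → ℤ) (N : ℕ) (κ : Fin (d + 1)) (y : Fin (d + 1) → ℤ) (b : Bond (d + 1)) :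
    linAvgAt ρ (univForm d) N κ y b = linCountAt ρ N κ y b := by
  have h := linAvgAt_mapForm (Finsupp.applyAddHom b) ρ (univForm d) N κ y
  rw [mapForm_applyAddHom_univForm, Finsupp.applyAddHom_apply] at h
  rw [← h]
  rfl

/-- **[folklore] THE ROOTED AVERAGING IS THE `Finsupp` SUM OF ITS BOND COUNTS AGAINST THE FORM** (universal coefficients). -/
theorem linAvgAt_eq_finsupp_sum (ρ : Fin (d + 1) → ℤ) (N : ℕ) (A : Form1 (d + 1) ℝ) (κ : Fin (d + 1)) (y : Fin (d + 1) → ℤ) :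
    linAvgAt ρ A N κ y = (linAvgAt ρ (univForm d) N κ y).sum (fun b n => (n : ℝ) * A b.1 b.2) := by
  conv_lhs => rw [← mapForm_lift_univForm A]
  rw [linAvgAt_mapForm, Finsupp.liftAddHom_apply]
  refine Finsupp.sum_congr fun b _ => ?_
  rw [zmultiplesHom_apply, zsmul_eq_mul]

/-- the finite window of sites carrying the letters of the rooted contours of the coarse bond at `y` (an1's `Near`, as a `Finset`). [our object] -/
def nearBox (N : ℕ) (y : Fin (d + 1) → ℤ) : Finset (Fin (d + 1) → ℤ) :=
  Fintype.piFinset fun i => Finset.Icc ((N : ℤ) * y i) ((N : ℤ) * y i + (2 * N - 1))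

/-- membership in `nearBox` is an1's `Near`. -/
theorem mem_nearBox {N : ℕ} {y z : Fin (d + 1) → ℤ} : z ∈ nearBox N y ↔ Near N y z := by
  simp only [nearBox, Fintype.mem_piFinset, Finset.mem_Icc, Near]

/-- off the window every bond count vanishes (in-block root). -/
theorem linCountAt_eq_zero_of_not_mem {N : ℕ} {r : Fin (d + 1) → ℕ} (hr : r ∈ box (d + 1) N) (κ : Fin (d + 1)) {y z : Fin (d + 1) → ℤ}
    (hz : z ∉ nearBox N y) (l : Fin (d + 1)) : linCountAt (toSite r) N κ y (l, z) = 0 :=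
  linCountAt_eq_zero hr (f := (l, z)) (fun h => hz (mem_nearBox.2 h))

/-- **[folklore] THE ROOTED AVERAGING IS REPRESENTED BY ITS BOND COUNTS**: for EVERY real 1-form `A` (in-block root `ρ = toSite r`),
`Σ_z Σ_l linCountAt ρ N κ y (l, z) · A l z` converges (finitely) to `linAvgAt ρ A N κ y`. -/
theorem hasSum_linCountAt_mul {N : ℕ} {r : Fin (d + 1) → ℕ} (hr : r ∈ box (d + 1) N) (A : Form1 (d + 1) ℝ) (κ : Fin (d + 1))
    (y : Fin (d + 1) → ℤ) :
    HasSum (fun z : Fin (d + 1) → ℤ => ∑ l : Fin (d + 1), (linCountAt (toSite r) N κ y (l, z) : ℝ) * A l z) (linAvgAt (toSite r) A N κ y) := by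
  have hfin : ∀ z ∉ nearBox N y, ∑ l : Fin (d + 1), (linCountAt (toSite r) N κ y (l, z) : ℝ) * A l z = 0 := fun z hz =>
    Finset.sum_eq_zero fun l _ => by rw [linCountAt_eq_zero_of_not_mem hr κ hz l, Int.cast_zero, zero_mul]
  have hsum : HasSum (fun z : Fin (d + 1) → ℤ => ∑ l : Fin (d + 1), (linCountAt (toSite r) N κ y (l, z) : ℝ) * A l z)
      (∑ z ∈ nearBox N y, ∑ l : Fin (d + 1), (linCountAt (toSite r) N κ y (l, z) : ℝ) * A l z) :=
    hasSum_sum_of_ne_finset_zero hfin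
  suffices heq : ∑ z ∈ nearBox N y, ∑ l : Fin (d + 1), (linCountAt (toSite r) N κ y (l, z) : ℝ) * A l z = linAvgAt (toSite r) A N κ y by
    rwa [heq] at hsum
  rw [linAvgAt_eq_finsupp_sum, Finsupp.sum_of_support_subset (s := (Finset.univ : Finset (Fin (d + 1))) ×ˢ nearBox N y)]
  · rw [Finset.sum_product_right]
    refine Finset.sum_congr rfl fun z _ => Finset.sum_congr rfl fun l _ => ?_
    rw [linAvgAt_univForm_apply]
  · intro b hb
    rw [Finsupp.mem_support_iff, linAvgAt_univForm_apply] at hb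
    refine Finset.mem_product.2 ⟨Finset.mem_univ _, ?_⟩
    by_contra hz
    exact hb (by
      have := linCountAt_eq_zero_of_not_mem hr κ hz b.1
      simpa using this)
  · intro b _
    rw [Int.cast_zero, zero_mul]

/-- the `tsum` form of the representation. -/
theorem tsum_linCountAt_mul {N : ℕ} {r : Fin (d + 1) → ℕ} (hr : r ∈ box (d + 1) N) (A : Form1 (d + 1) ℝ) (κ : Fin (d + 1))
    (y : Fin (d + 1) → ℤ) :
    ∑' z : Fin (d + 1) → ℤ, ∑ l : Fin (d + 1), (linCountAt (toSite r) N κ y (l, z) : ℝ) * A l z = linAvgAt (toSite r) A N κ y :=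
  (hasSum_linCountAt_mul hr A κ y).tsum_eq

end Representation

/-! ## §3 The MASTER IDENTITY: periodised rooted averaging of a torus gradient = `#B ·` coarse gradient of the values at the roots -/

section Master

variable (M : Fin (d + 1) → ℕ) [∀ μ, NeZero (M μ)]
variable {N : ℕ} [NeZero N] {r : Fin (d + 1) → ℕ}

omit [∀ μ, NeZero (M μ)] [NeZero N] in
/-- a multiplier row of `bhKAt` off the coarse sublattice vanishes identically, hence so does its periodisation. -/
theorem perZ_bhKAt_inr_of_proj_ne {p : Fin (d + 1) → ℤ} (hp : Torus.proj N p ≠ 0) (y : Fin (d + 1) → ℤ) (κ : Fin (d + 1)) (b : Fib d) :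
    perZ M (bhKAt d (toSite r) N) p y (Sum.inr κ) b = 0 := by
  rw [perZ_apply]
  have h0 : ∀ m : Fin (d + 1) → ℤ, bhKAt d (toSite r) N p (translate M y m) (Sum.inr κ) b = 0 := fun m => by
    rcases b with l | l
    · rw [bhKAt_inr_inl, if_neg hp]
    · rw [bhKAt_inr_inr]
  simp only [h0, tsum_zero]

omit [∀ μ, NeZero (M μ)] [NeZero N] in
/-- the multiplier-row entries of `bhKAt` at a coarse point, as bond counts. -/
theorem bhKAt_inr_inl_of_proj {p : Fin (d + 1) → ℤ} (hp : Torus.proj N p = 0) (z : Fin (d + 1) → ℤ) (κ l : Fin (d + 1)) :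
    bhKAt d (toSite r) N p z (Sum.inr κ) (Sum.inl l) = (linCountAt (toSite r) N κ (quo N p) (l, z) : ℝ) := by
  rw [bhKAt_inr_inl, if_pos hp, linAvgAt_delta1_eq_cast]

/-- **MASTER IDENTITY for `bhKAt`**: for the in-block root `ρ = toSite r`, `N ≥ 1`, a box `M` with `N ∣ M i`, every multiplier row `(p, inr κ)`
and every column `s`:
`Σ_q perF M (bhKAt d ρ N) (p, inr κ) q · tgrad M q s = [proj N p = 0] · #B · (tdelta M (p + ρ + N•e_κ) s − tdelta M (p + ρ) s)`
— the periodised ROOTED averaging of the torus gradient of the periodic indicator of `s` is `#B` times the coarse gradient of that indicator's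
values at the block roots (an1's `linAvgAt_grad`, periodised). [folklore] -/
theorem perF_bhKAt_mul_tgrad (hr : r ∈ box (d + 1) N) (p : ↥(pbox M)) (κ : Fin (d + 1)) (s : ↥(pbox M)) :
    ∑ q : Idx M (Fib d), perF M (bhKAt d (toSite r) N) (p, Sum.inr κ) q * tgrad M q s
      = if Torus.proj N (p : Fin (d + 1) → ℤ) = 0 then
          ((box (d + 1) N).card : ℝ) *
            (tdelta M ((p : Fin (d + 1) → ℤ) + toSite r + (N : ℤ) • unitVec κ) s - tdelta M ((p : Fin (d + 1) → ℤ) + toSite r) s)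
        else 0 := by
  -- split the fibre sum; the multiplier slots of `tgrad` vanish
  rw [Fintype.sum_prod_type]
  have hsplit : ∀ y : ↥(pbox M), ∑ b : Fib d, perF M (bhKAt d (toSite r) N) (p, Sum.inr κ) (y, b) * tgrad M (y, b) s
      = ∑ l : Fin (d + 1), perZ M (bhKAt d (toSite r) N) (p : Fin (d + 1) → ℤ) (y : Fin (d + 1) → ℤ) (Sum.inr κ) (Sum.inl l)
          * grad (fun x => tdelta M x s) l (y : Fin (d + 1) → ℤ) := fun y => by
    rw [Fintype.sum_sum_type]
    simp only [perF_apply, tgrad_inr, mul_zero, Finset.sum_const_zero, add_zero, tgrad_inl_eq_grad]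
  simp only [hsplit]
  by_cases hp : Torus.proj N (p : Fin (d + 1) → ℤ) = 0
  · rw [if_pos hp]
    -- the summand family on `ℤ^{d+1}` (bond counts × the periodic gradient) and its finite support
    set G : Form1 (d + 1) ℝ := grad (fun x => tdelta M x s) with hG
    set H : Fin (d + 1) → (Fin (d + 1) → ℤ) → ℝ :=
      fun l z => (linCountAt (toSite r) N κ (quo N (p : Fin (d + 1) → ℤ)) (l, z) : ℝ) * G l z with hH
    have hHfin : ∀ l, ∀ z ∉ nearBox N (quo N (p : Fin (d + 1) → ℤ)), H l z = 0 := fun l z hz => by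
      simp only [hH]
      rw [linCountAt_eq_zero_of_not_mem hr κ hz l, Int.cast_zero, zero_mul]
    have hHs : ∀ l, Summable (H l) := fun l => summable_of_ne_finset_zero (hHfin l)
    -- each periodised entry times the (periodic) gradient is the period sum of `H l` over the copies of `y`
    have hterm : ∀ (y : ↥(pbox M)) (l : Fin (d + 1)),
        perZ M (bhKAt d (toSite r) N) (p : Fin (d + 1) → ℤ) (y : Fin (d + 1) → ℤ) (Sum.inr κ) (Sum.inl l) * G l (y : Fin (d + 1) → ℤ)
          = ∑' m : Fin (d + 1) → ℤ, H l (translate M (y : Fin (d + 1) → ℤ) m) := fun y l => by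
      rw [perZ_apply, ← tsum_mul_right]
      refine tsum_congr fun m => ?_
      simp only [hH, hG]
      rw [bhKAt_inr_inl_of_proj (r := r) hp, grad_tdelta_translate]
    calc ∑ y : ↥(pbox M), ∑ l : Fin (d + 1),
          perZ M (bhKAt d (toSite r) N) (p : Fin (d + 1) → ℤ) (y : Fin (d + 1) → ℤ) (Sum.inr κ) (Sum.inl l) * G l (y : Fin (d + 1) → ℤ)
        = ∑ y : ↥(pbox M), ∑ l : Fin (d + 1), ∑' m : Fin (d + 1) → ℤ, H l (translate M (y : Fin (d + 1) → ℤ) m) := by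
          refine Finset.sum_congr rfl fun y _ => Finset.sum_congr rfl fun l _ => hterm y l
      _ = ∑ l : Fin (d + 1), ∑ y : ↥(pbox M), ∑' m : Fin (d + 1) → ℤ, H l (translate M (y : Fin (d + 1) → ℤ) m) := Finset.sum_comm
      _ = ∑ l : Fin (d + 1), ∑' z : Fin (d + 1) → ℤ, H l z := by
          refine Finset.sum_congr rfl fun l _ => (tsum_sites_eq_sum_tsum M (hHs l)).symm
      _ = ∑' z : Fin (d + 1) → ℤ, ∑ l : Fin (d + 1), H l z := (Summable.tsum_finsetSum fun l _ => hHs l).symm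
      _ = linAvgAt (toSite r) G N κ (quo N (p : Fin (d + 1) → ℤ)) := by
          simp only [hH]; exact tsum_linCountAt_mul hr G κ (quo N (p : Fin (d + 1) → ℤ))
      _ = ((box (d + 1) N).card : ℝ) * (tdelta M ((N : ℤ) • quo N (p : Fin (d + 1) → ℤ) + toSite r + (N : ℤ) • unitVec κ) s
            - tdelta M ((N : ℤ) • quo N (p : Fin (d + 1) → ℤ) + toSite r) s) := by
          rw [hG, linAvgAt_grad, nsmul_eq_mul]
      _ = _ := by rw [← eq_zsmul_quo_of_proj hp]
  · rw [if_neg hp]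
    refine Finset.sum_eq_zero fun y _ => Finset.sum_eq_zero fun l _ => ?_
    rw [perZ_bhKAt_inr_of_proj_ne M hp, zero_mul]

omit [∀ μ, NeZero (M μ)] [NeZero N] in
/-- the multiplier rows of `bhKStepAt d ρ Lc j` are `stepScale d Lc j ·` those of `bhKAt d ρ Lc` (at `j = 0` the scale is `1`). -/
theorem bhKStepAt_inr (ρ : Fin (d + 1) → ℤ) (Lc : ℕ) [NeZero Lc] (j : ℕ) (x y : Fin (d + 1) → ℤ) (κ : Fin (d + 1)) (b : Fib d) :
    bhKStepAt d ρ Lc j x y (Sum.inr κ) b = stepScale d Lc j * bhKAt d ρ Lc x y (Sum.inr κ) b := by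
  cases j with
  | zero =>
    have h1 : stepScale d Lc 0 = 1 := by simp [stepScale]
    rw [bhKStepAt_zero, h1, one_mul]
  | succ j =>
    rcases b with l | l
    · exact bhKStepAt_succ_mf j x y κ l
    · rw [bhKStepAt_succ_mm, bhKAt_inr_inr, mul_zero]

omit [∀ μ, NeZero (M μ)] [NeZero N] in
/-- periodising a scaled multiplier row scales the periodisation. -/
theorem perF_bhKStepAt_inr (ρ : Fin (d + 1) → ℤ) (Lc : ℕ) [NeZero Lc] (j : ℕ) (p : ↥(pbox M)) (κ : Fin (d + 1)) (q : Idx M (Fib d)) :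
    perF M (bhKStepAt d ρ Lc j) (p, Sum.inr κ) q = stepScale d Lc j * perF M (bhKAt d ρ Lc) (p, Sum.inr κ) q := by
  rw [perF_apply, perF_apply, perZ_apply, perZ_apply, ← tsum_mul_left]
  exact tsum_congr fun m => bhKStepAt_inr ρ Lc j _ _ κ q.2

/-- **MASTER IDENTITY for `bhKStepAt` at every `j`** (blocking `Lc`, in-block root, box with `Lc ∣ M i`): the multiplier rows of the periodised
step-`j` packed Hessian against the torus gradient columns = `stepScale d Lc j · [proj Lc p = 0] · #B · (coarse gradient of the indicator at the roots)`. -/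
theorem perF_bhKStepAt_mul_tgrad {Lc : ℕ} [NeZero Lc] {r : Fin (d + 1) → ℕ} (hr : r ∈ box (d + 1) Lc) (j : ℕ) (p : ↥(pbox M))
    (κ : Fin (d + 1)) (s : ↥(pbox M)) :
    ∑ q : Idx M (Fib d), perF M (bhKStepAt d (toSite r) Lc j) (p, Sum.inr κ) q * tgrad M q s
      = stepScale d Lc j *
          (if Torus.proj Lc (p : Fin (d + 1) → ℤ) = 0 then
            ((box (d + 1) Lc).card : ℝ) *
              (tdelta M ((p : Fin (d + 1) → ℤ) + toSite r + (Lc : ℤ) • unitVec κ) s - tdelta M ((p : Fin (d + 1) → ℤ) + toSite r) s)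
           else 0) := by
  rw [← perF_bhKAt_mul_tgrad M hr p κ s, Finset.mul_sum]
  refine Finset.sum_congr rfl fun q _ => ?_
  rw [perF_bhKStepAt_inr, mul_assoc]

end Master

/-! ## §4 Corollary (C1): non-root columns are killed — «`Q₁·D₁ = 0`» for the residual algebra of the rooted comb chart -/

section Residual

variable (M : Fin (d + 1) → ℕ) [∀ μ, NeZero (M μ)]

/-- **(C1) for `bhKAt`**: every multiplier row of the periodised rooted packed Hessian kills the torus gradient column of a NON-root site
(`N ∣ M i`): the residual gauge parameters «`λ = 0` at the block roots» do not move the rooted block averages. [folklore] -/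
theorem perF_bhKAt_mul_tgrad_of_not_root {N : ℕ} [NeZero N] {r : Fin (d + 1) → ℕ} (hr : r ∈ box (d + 1) N) (hM : ∀ i, N ∣ M i)
    (p : ↥(pbox M)) (κ : Fin (d + 1)) {s : ↥(pbox M)} (hs : Torus.proj N ((s : Fin (d + 1) → ℤ) - toSite r) ≠ 0) :
    ∑ q : Idx M (Fib d), perF M (bhKAt d (toSite r) N) (p, Sum.inr κ) q * tgrad M q s = 0 := by
  rw [perF_bhKAt_mul_tgrad M hr]
  split_ifs with hp
  · have h1 : Torus.proj N ((p : Fin (d + 1) → ℤ) + toSite r + (N : ℤ) • unitVec κ - toSite r) = 0 := by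
      rw [show (p : Fin (d + 1) → ℤ) + toSite r + (N : ℤ) • unitVec κ = (N : ℤ) • (quo N (p : Fin (d + 1) → ℤ) + unitVec κ) + toSite r by
        rw [smul_add, ← eq_zsmul_quo_of_proj hp]; abel]
      exact proj_sub_eq_zero_of_zsmul_add _ _ _
    have h2 : Torus.proj N ((p : Fin (d + 1) → ℤ) + toSite r - toSite r) = 0 := by
      rw [show (p : Fin (d + 1) → ℤ) + toSite r = (N : ℤ) • quo N (p : Fin (d + 1) → ℤ) + toSite r by rw [← eq_zsmul_quo_of_proj hp]]
      exact proj_sub_eq_zero_of_zsmul_add _ _ _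
    rw [tdelta_eq_zero_of_root M hM h1 hs, tdelta_eq_zero_of_root M hM h2 hs, sub_zero, mul_zero]
  · rfl

/-- **(C1) for `bhKStepAt` at every `j`.** -/
theorem perF_bhKStepAt_mul_tgrad_of_not_root {Lc : ℕ} [NeZero Lc] {r : Fin (d + 1) → ℕ} (hr : r ∈ box (d + 1) Lc)
    (hM : ∀ i, Lc ∣ M i) (j : ℕ) (p : ↥(pbox M)) (κ : Fin (d + 1)) {s : ↥(pbox M)} (hs : Torus.proj Lc ((s : Fin (d + 1) → ℤ) - toSite r) ≠ 0) :
    ∑ q : Idx M (Fib d), perF M (bhKStepAt d (toSite r) Lc j) (p, Sum.inr κ) q * tgrad M q s = 0 := by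
  have h := perF_bhKAt_mul_tgrad_of_not_root M hr hM p κ hs
  rw [perF_bhKAt_mul_tgrad M hr] at h
  rw [perF_bhKStepAt_mul_tgrad M hr, h, mul_zero]

end Residual

end Summit.QuantumFields.BalabanUV.Beta.FP.TorusGaugeCovariance

end
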